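import Literature.Combinatorics.Enumerative.AperyShiftedSupercongruenceRatioProofs
import Literature.Combinatorics.Enumerative.MultivariateAperyGZeroProofs
import Literature.Combinatorics.Enumerative.MultivariateAperyNumbers
import Mathlib.NumberTheory.Padics.PadicIntegers
import Mathlib.Tactic
import HarnessLib

/-!
# Beukers 1985, Theorem 1 for the Apéry numbers: `A(p^r m − 1) ≡ A(p^{r−1} m − 1) (mod p^{3r})`, `p ≥ 5`

Topic `Literature/Combinatorics/Enumerative`, namespace
`Literature.Combinatorics.Enumerative.AperyShiftedSupercongruenceProofs` (second of two files, after
`AperyShiftedSupercongruenceRatioProofs`). PROOF FILE: sorry-free theorems only — no definition, no named fact;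
it DISCHARGES the named fact `MultivariateAperyNumbers.beukers1985_supercongruence` (Beukers' shifted
prime-power supercongruence as printed in [Straub2014] (3)). Sources read on the page: F. Beukers, *Some
congruences for the Apéry numbers*, J. Number Theory **21** (1985) 141–155 [Beukers1985], Theorem 1 (p. 142);
A. Straub, *Multivariate Apéry numbers and supercongruences of rational functions*, Algebra Number Theory **8**
(2014) [Straub2014], (3) and the proof of Theorem 1.2 (§5, (46)).

HONEST FRAMING (cell pub-zeta5): a classical `p`-adic supercongruence for Apéry's `ζ(3)` numbers
`A(n) = Σ_k C(n,k)² C(n+k,k)²` (tree: `AperyNumbers.aperyNumber`), made a theorem of the tree by a route through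
theorems already in the tree; nothing about `ζ(5)`, no irrationality statement.

## Route (NOT Beukers' «brute force method», pp. 143–155): absorption onto Straub's machinery at nonnegative arguments

`N = p^r m = Mp`, `F(n, k) = C(n, k)² C(n + k, k)²` (`AperyNumbers.aperyTerm`).
1. `A(N − 1) = Σ_{p ∤ k < N} F(N − 1, k) + Σ_{K < M} F(N − 1, Kp)` (`sum_range_mul_ite_dvd`).
2. Multiples of `p`: `F(N − 1, Kp) ≡ F(M − 1, K) (mod p^{3r})` for `1 ≤ K < M`
   (`AperyShiftedSupercongruenceRatioProofs.shifted_term_modEq`), and `F(·, 0) = 1`; so the second sum is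
   `≡ A(M − 1)`.
3. The `p`-free part vanishes modulo `p^{3r}` (`pow_dvd_sum_not_dvd_shifted`): by
   `k·C(N − 1 + k, k) = N·C(N − 1 + k, k − 1)`, in `ℤ_p` one has `F(N − 1, k) = N² k⁻² C(N−1, k)² C(N−1+k, k−1)²`
   for `p ∤ k`, and it remains to see `p^r ∣ Σ_{k<N} k⁻² C(N−1,k)² C(N−1+k, k−1)²` (weights `k⁻² = (Ring.inverse k)²`,
   vanishing for `p ∣ k`). The tree's form of [Straub2014] (46), `MultivariateAperyPrimePowerProofs.
   pow_dvd_sum_weights_companion` at `𝐧 = (m,m,m,m)`, is `p^r ∣ Σ_{k<N} k⁻² C(N−1,k)² C(2N−k−1, N)²`; the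
   reflection `k ↦ N − k` turns its summand into `(N−k)⁻² C(N−1, k−1)² C(N−1+k, N)²`, and
   `k·C(N−1, k) = (N−k)·C(N−1, k−1)` with `k⁻¹ + (N−k)⁻¹ = k⁻¹(N−k)⁻¹·N ≡ 0 (mod p^r)` identifies the two sums
   termwise modulo `p^r` (`C(N−1+k, N) = C(N−1+k, k−1)`).

WHERE `p ≥ 5` ENTERS: only in step 3, through the block sums `Σ_{[k/p^s] = l} k⁻² ≡ 0 (mod p^s)` of
[Straub2014] Lemma 5.2 inside `pow_dvd_sum_weights_companion`; step 2 needs `p > 3` (Jacobsthal). The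
`ℕ`-subtractions `p^r m − 1`, `p^{r−1} m − 1` of the typed fact are honest because `m, r ≥ 1` (`p^{r−1} m ≥ 1`).

* `sum_range_mul_ite_dvd` — `Σ_{k < Mp, p ∣ k} f(k) = Σ_{K < M} f(Kp)`;
* `pow_dvd_sum_not_dvd_shifted` — step 3; `three_mul_le_exponent` — the exponent bookkeeping of step 2
  (`J + e ≥ 3r`) with its two cases written out (referee aid; `shifted_term_modEq` discharges the same
  inequality by `omega`); `aperyNumber_shifted_prime_pow_modEq` — the congruence;
* **`beukers1985_supercongruence_holds : MultivariateAperyNumbers.beukers1985_supercongruence`**.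
-/

open Finset

namespace Literature.Combinatorics.Enumerative.AperyShiftedSupercongruenceProofs

open MultivariateAperyPrimePowerProofs (pow_dvd_sum_weights_companion)
open AperyNumbers (aperyTerm aperyNumber aperyTerm_zero)

section PFree

variable {p : ℕ} [hp : Fact p.Prime]

omit hp in
/-- A natural number is a unit of `ℤ_p` iff it is prime to `p`. [folklore] -/
private theorem isUnit_natCast_padicInt_iff' [Fact p.Prime] (K : ℕ) : IsUnit ((K : ℤ_[p])) ↔ ¬ p ∣ K := by
  rw [PadicInt.isUnit_iff, ← PadicInt.norm_natCast_lt_one_iff (p := p)]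
  have := PadicInt.norm_le_one ((K : ℤ_[p]))
  constructor
  · intro h; rw [h]; exact lt_irrefl 1
  · intro h; exact le_antisymm this (not_lt.mp h)

/-- `Ring.inverse k · k = 1` in `ℤ_p` for `p ∤ k`. [folklore] -/
private theorem ringInverse_natCast_mul_self' {K : ℕ} (hK : ¬ p ∣ K) :
    Ring.inverse ((K : ℤ_[p])) * (K : ℤ_[p]) = 1 :=
  Ring.inverse_mul_cancel _ ((isUnit_natCast_padicInt_iff' K).mpr hK)

/-- `Ring.inverse k = 0` in `ℤ_p` for `p ∣ k`. [folklore] -/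
private theorem ringInverse_natCast_of_dvd' {K : ℕ} (hK : p ∣ K) : Ring.inverse ((K : ℤ_[p])) = 0 :=
  Ring.inverse_non_unit _ (fun h => (isUnit_natCast_padicInt_iff' K).mp h hK)

omit hp in
/-- Reflection `k ↦ N − k` on `range N` for a summand vanishing at `0` and at `N`. [folklore] -/
private theorem sum_range_reflect_shift {R : Type*} [AddCommMonoid R] (g : ℕ → R) (N : ℕ) (h0 : g 0 = 0)
    (hN : g N = 0) : ∑ k ∈ range N, g (N - k) = ∑ k ∈ range N, g k := by
  have h1 : ∑ k ∈ range N, g (N - k) = ∑ k ∈ range N, g (k + 1) := by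
    rw [← Finset.sum_range_reflect (fun j => g (j + 1)) N]
    refine Finset.sum_congr rfl fun k hk => ?_
    rw [Finset.mem_range] at hk
    congr 1
    omega
  have h2 := Finset.sum_range_succ' g N
  have h3 := Finset.sum_range_succ g N
  rw [h0, add_zero] at h2
  rw [hN, add_zero] at h3
  rw [h1, ← h2, h3]

omit hp in
/-- The multiples of `p` below `Mp` are the `Kp`, `K < M`: `Σ_{k < Mp, p ∣ k} f(k) = Σ_{K < M} f(Kp)`. [folklore] -/
private theorem sum_range_mul_ite_dvd {R : Type*} [AddCommMonoid R] (hp0 : 0 < p) (f : ℕ → R) (M : ℕ) :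
    ∑ k ∈ range (M * p), (if p ∣ k then f k else 0) = ∑ K ∈ range M, f (K * p) := by
  induction M with
  | zero => simp
  | succ M ih =>
    rw [Nat.succ_mul, Finset.sum_range_add, ih, Finset.sum_range_succ]
    congr 1
    rw [Finset.sum_eq_single 0]
    · rw [if_pos (by simp)]
      simp
    · intro i hi hi0
      rw [Finset.mem_range] at hi
      rw [if_neg]
      intro hdvd
      have hi' : p ∣ i := (Nat.dvd_add_right (dvd_mul_left p M)).mp hdvd
      exact absurd (Nat.le_of_dvd (Nat.pos_of_ne_zero hi0) hi') (not_le.mpr hi)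
    · intro h
      exact absurd (Finset.mem_range.mpr hp0) h

/-- **The `p`-free part of `A(p^r m − 1)` vanishes modulo `p^{3r}`**: for a prime `p ≥ 5`, `r, m ≥ 1`,
`p^{3r} ∣ Σ_{0 ≤ k < p^r m, p ∤ k} C(p^r m − 1, k)² C(p^r m − 1 + k, k)²`. Route: `k·C(N−1+k, k) = N·C(N−1+k, k−1)`
makes each term `N² k⁻² C(N−1,k)² C(N−1+k,k−1)²` in `ℤ_p`; the weighted sum is identified modulo `p^r`, via the
reflection `k ↦ N − k` and `k·C(N−1,k) = (N−k)·C(N−1,k−1)`, with the tree's weighted companion sum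
([Straub2014] (46), `pow_dvd_sum_weights_companion` at `𝐧 = (m,m,m,m)`), which is `≡ 0 (mod p^r)` — this is
where `p ≥ 5` enters (Straub's Lemma 5.2). [cite: Beukers1985, Theorem 1 (second congruence)]
[cite: Straub2014, Theorem 1.2 (proof, (46))] -/
theorem pow_dvd_sum_not_dvd_shifted (h5 : 5 ≤ p) {r : ℕ} (hr : 1 ≤ r) {m : ℕ} (hm : 1 ≤ m) :
    (p : ℤ) ^ (3 * r) ∣ ∑ k ∈ range (p ^ r * m),
      (if p ∣ k then 0 else ((aperyTerm (p ^ r * m - 1) k : ℕ) : ℤ)) := by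
  have hp' := hp.out
  have hp0 : 0 < p := hp'.pos
  set N := p ^ r * m with hN
  have hN1 : 1 ≤ N := Nat.mul_pos (pow_pos hp0 r) hm
  have hpN : p ∣ N := (dvd_pow_self p (by omega : r ≠ 0)).mul_right m
  have hNcast : (N : ℤ_[p]) = (p : ℤ_[p]) ^ r * m := by rw [hN]; push_cast; ring
  -- pass to `ℤ_p`
  rw [← PadicInt.pow_p_dvd_int_iff]
  push_cast
  -- Step 1: termwise, `F(N−1, k) = (p^r m)² · k⁻² C(N−1,k)² C(N−1+k,k−1)²` (`p ∤ k`), `0 = … · 0` (`p ∣ k`)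
  have hterm : ∀ k ∈ range N, (if p ∣ k then (0 : ℤ_[p]) else ((aperyTerm (N - 1) k : ℕ) : ℤ_[p])) =
      ((p : ℤ_[p]) ^ r * m) ^ 2 * ((Ring.inverse ((k : ℤ_[p]))) ^ 2 *
        ((((N - 1).choose k : ℕ) : ℤ_[p]) ^ 2 * ((((N - 1 + k).choose (k - 1) : ℕ) : ℤ_[p])) ^ 2)) := by
    intro k _
    split_ifs with hk
    · rw [ringInverse_natCast_of_dvd' hk, zero_pow two_ne_zero, zero_mul, mul_zero]
    · have hk1 : 1 ≤ k := Nat.one_le_iff_ne_zero.mpr fun h => hk (h ▸ dvd_zero p)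
      -- `C(N−1+k, k)·k = C(N−1+k, k−1)·N`
      have hid : (N - 1 + k).choose k * k = (N - 1 + k).choose (k - 1) * N := by
        have := Nat.choose_succ_right_eq (N - 1 + k) (k - 1)
        rwa [Nat.sub_add_cancel hk1, show N - 1 + k - (k - 1) = N by omega] at this
      have hcast := congrArg (Nat.cast : ℕ → ℤ_[p]) hid
      push_cast at hcast
      rw [hNcast] at hcast
      have hu := ringInverse_natCast_mul_self' (p := p) hk
      set u := Ring.inverse ((k : ℤ_[p])) with hu'
      have hE : (((N - 1 + k).choose k : ℕ) : ℤ_[p]) =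
          u * ((((N - 1 + k).choose (k - 1) : ℕ) : ℤ_[p]) * ((p : ℤ_[p]) ^ r * m)) := by
        calc (((N - 1 + k).choose k : ℕ) : ℤ_[p])
            = (((N - 1 + k).choose k : ℕ) : ℤ_[p]) * (u * (k : ℤ_[p])) := by rw [hu, mul_one]
          _ = u * ((((N - 1 + k).choose k : ℕ) : ℤ_[p]) * (k : ℤ_[p])) := by ring
          _ = _ := by rw [hcast]
      simp only [aperyTerm]
      push_cast
      rw [hE]
      ring
  rw [Finset.sum_congr rfl hterm, ← Finset.mul_sum,
    show 3 * r = r * 2 + r by ring, pow_add, pow_mul]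
  rw [show ((p : ℤ_[p]) ^ r * m) ^ 2 = ((p : ℤ_[p]) ^ r) ^ 2 * (m : ℤ_[p]) ^ 2 by ring, mul_assoc]
  refine mul_dvd_mul_left _ (Dvd.dvd.mul_left ?_ _)
  -- Step 2: the tree's weighted companion sum (46) at `𝐧 = (m,m,m,m)`, reflected by `k ↦ N − k`
  set g : ℕ → ℤ_[p] := fun k => (Ring.inverse ((k : ℤ_[p]))) ^ 2 *
      (((N - 1).choose k * (N - 1).choose k * (N + N - k - 1).choose N * (N + N - k - 1).choose N : ℕ) :
        ℤ_[p]) with hg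
  have hS : (p : ℤ_[p]) ^ r ∣ ∑ k ∈ range N, g k := by
    have h := pow_dvd_sum_weights_companion (p := p) h5 r hm hm m m
    rw [mul_comm m (p ^ r)] at h
    exact h
  have hg0 : g 0 = 0 := by
    simp only [hg, Nat.cast_zero, Ring.inverse_zero, zero_pow two_ne_zero, zero_mul]
  have hgN : g N = 0 := by
    simp only [hg]
    rw [ringInverse_natCast_of_dvd' hpN, zero_pow two_ne_zero, zero_mul]
  rw [← sum_range_reflect_shift g N hg0 hgN] at hS
  -- Step 3: the two weighted sums agree termwise modulo `p^r`
  have hdiff : (p : ℤ_[p]) ^ r ∣ ∑ k ∈ range N, ((Ring.inverse ((k : ℤ_[p]))) ^ 2 *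
      ((((N - 1).choose k : ℕ) : ℤ_[p]) ^ 2 * ((((N - 1 + k).choose (k - 1) : ℕ) : ℤ_[p])) ^ 2) - g (N - k)) := by
    refine Finset.dvd_sum fun k hk => ?_
    rw [Finset.mem_range] at hk
    have hkN : k ≤ N := hk.le
    by_cases hpk : p ∣ k
    · -- both weights vanish
      have hpNk : p ∣ N - k := Nat.dvd_sub hpN hpk
      simp only [hg]
      rw [ringInverse_natCast_of_dvd' hpk, ringInverse_natCast_of_dvd' hpNk, zero_pow two_ne_zero, zero_mul,
        zero_mul, sub_zero]
      exact dvd_zero _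
    · have hk1 : 1 ≤ k := Nat.one_le_iff_ne_zero.mpr fun h => hpk (h ▸ dvd_zero p)
      have hpNk : ¬ p ∣ N - k := fun h => hpk (by
        have := Nat.dvd_sub hpN h
        rwa [Nat.sub_sub_self hkN] at this)
      -- rewrite the reflected companion term: `C(N−1, N−k) = C(N−1, k−1)`, `C(N+N−(N−k)−1, N) = C(N−1+k, k−1)`
      have e1 : (N - 1).choose (N - k) = (N - 1).choose (k - 1) := by
        rw [show N - k = (N - 1) - (k - 1) by omega, Nat.choose_symm (by omega)]
      have e2 : (N + N - (N - k) - 1).choose N = (N - 1 + k).choose (k - 1) := by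
        rw [show N + N - (N - k) - 1 = N - 1 + k by omega]
        exact Nat.choose_symm_of_eq_add (by omega)
      have hgk : g (N - k) = (Ring.inverse (((N - k : ℕ) : ℤ_[p]))) ^ 2 *
          ((((N - 1).choose (k - 1) : ℕ) : ℤ_[p]) ^ 2 * ((((N - 1 + k).choose (k - 1) : ℕ) : ℤ_[p])) ^ 2) := by
        simp only [hg, e1, e2]
        push_cast
        ring
      rw [hgk]
      -- the units `u = k⁻¹`, `v = (N−k)⁻¹` and the absorption `k·C(N−1,k) = (N−k)·C(N−1,k−1)`
      have hu := ringInverse_natCast_mul_self' (p := p) hpk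
      have hv := ringInverse_natCast_mul_self' (p := p) hpNk
      rw [Nat.cast_sub hkN, hNcast] at hv
      rw [Nat.cast_sub hkN, hNcast]
      set u := Ring.inverse ((k : ℤ_[p])) with hu'
      set v := Ring.inverse ((p : ℤ_[p]) ^ r * m - (k : ℤ_[p])) with hv'
      have hid : (N - 1).choose k * k = (N - 1).choose (k - 1) * (N - k) := by
        have := Nat.choose_succ_right_eq (N - 1) (k - 1)
        rwa [Nat.sub_add_cancel hk1, show N - 1 - (k - 1) = N - k by omega] at this
      have hD := congrArg (Nat.cast : ℕ → ℤ_[p]) hid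
      push_cast at hD
      rw [Nat.cast_sub hkN, hNcast] at hD
      set D := (((N - 1).choose k : ℕ) : ℤ_[p]) with hD'
      set C := (((N - 1).choose (k - 1) : ℕ) : ℤ_[p]) with hC'
      set C' := (((N - 1 + k).choose (k - 1) : ℕ) : ℤ_[p]) with hC''
      set X := (p : ℤ_[p]) ^ r * m - (k : ℤ_[p]) with hX
      have hDu : D = u * C * X := by
        calc D = D * (u * (k : ℤ_[p])) := by rw [hu, mul_one]
          _ = u * (D * (k : ℤ_[p])) := by ring
          _ = u * (C * X) := by rw [hD]
          _ = u * C * X := by ring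
      have huv : u + v = u * v * ((p : ℤ_[p]) ^ r * m) := by
        calc u + v = u * (v * X) + v * (u * (k : ℤ_[p])) := by rw [hv, hu, mul_one, mul_one]
          _ = u * v * ((p : ℤ_[p]) ^ r * m) := by rw [hX]; ring
      refine ⟨(m : ℤ_[p]) * (u ^ 2 - u * v) * (u ^ 2 * X + v) * C ^ 2 * C' ^ 2, ?_⟩
      linear_combination (u ^ 2 * C' ^ 2 * (D + u * C * X)) * hDu
        + (-(u * C ^ 2 * C' ^ 2 * (u ^ 2 * X + v))) * hu
        + (-(C ^ 2 * C' ^ 2 * (u ^ 2 * X + v))) * huv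
  have := dvd_add hdiff hS
  rw [← Finset.sum_add_distrib] at this
  simpa using this

end PFree

section Assembly

/-- **The exponent bookkeeping of step 2, cases spelled out** (referee aid). In `shifted_term_modEq` the unit
ratio holds modulo `p^J` with `J ≥ 3 + a + t + min(a, t)` (`a = v_p(M) ≥ r − 1`, `t = v_p(K)`; the Jacobsthal
exponents are `3 + v(M) + v(K) + v(M − K)` and `3 + v(M + K) + v(K) + v(M)`, and `v(M ∓ K) ≥ min(a, t)`), while
`p^e ∣ F(M − 1, K)` with `e = 2(a − t)` (truncated subtraction). Then `J + e ≥ 3r` in both cases: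
`t ≤ a`: `3 + a + t + t + 2(a − t) = 3 + 3a ≥ 3 + 3(r − 1) = 3r`; `t > a`: `3 + a + t + a + 0 ≥ 3 + 2a + (a + 1) =
3a + 4 > 3r`. (The same inequality is discharged by `omega` inside `shifted_term_modEq`.)
[cite: Beukers1985, Theorem 1 (second congruence)] -/
theorem three_mul_le_exponent {r a t : ℕ} (har : r - 1 ≤ a) :
    3 * r ≤ 3 + a + t + min a t + 2 * (a - t) := by
  rcases le_or_gt t a with hta | hat
  · -- case `t ≤ a`: `min a t = t`, `a - t` honest; total `3 + 3a`
    rw [min_eq_right hta]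
    have : t + (a - t) = a := Nat.add_sub_cancel' hta
    omega
  · -- case `t > a`: `min a t = a`, `a - t = 0`; total `3 + 2a + t ≥ 3a + 4`
    rw [min_eq_left hat.le, Nat.sub_eq_zero_of_le hat.le]
    omega

variable {p : ℕ} [hp : Fact p.Prime]

/-- **Beukers 1985, Theorem 1 (second congruence), in the tree's variables**: for a prime `p ≥ 5`, `r, m ≥ 1`,
`A(p^r m − 1) ≡ A(p^{r−1} m − 1) (mod p^{3r})` for the Apéry numbers `A(n) = Σ_k C(n,k)² C(n+k,k)²`.
[cite: Beukers1985, Theorem 1 (second congruence)] [cite: Straub2014, (3)] -/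
theorem aperyNumber_shifted_prime_pow_modEq (h5 : 5 ≤ p) {r : ℕ} (hr : 1 ≤ r) {m : ℕ} (hm : 1 ≤ m) :
    (aperyNumber (p ^ r * m - 1) : ℤ) ≡ aperyNumber (p ^ (r - 1) * m - 1) [ZMOD (p : ℤ) ^ (3 * r)] := by
  have hp' := hp.out
  have hp0 : 0 < p := hp'.pos
  have h3 : 3 < p := by omega
  set M := p ^ (r - 1) * m with hM
  have hM1 : 1 ≤ M := Nat.mul_pos (pow_pos hp0 _) hm
  have hMr : p ^ (r - 1) ∣ M := Dvd.intro m rfl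
  have hNM : p ^ r * m = M * p := by
    rw [hM, show p ^ r = p ^ (r - 1) * p by rw [← pow_succ, Nat.sub_add_cancel hr]]; ring
  -- the `p`-free part
  have hfree := pow_dvd_sum_not_dvd_shifted (p := p) h5 hr hm
  rw [hNM] at hfree ⊢
  -- unfold the two Apéry numbers as sums over `range (Mp)` and `range M`
  have hA : aperyNumber (M * p - 1) = ∑ k ∈ range (M * p), aperyTerm (M * p - 1) k := by
    rw [aperyNumber, Nat.sub_add_cancel (Nat.mul_pos hM1 hp0)]
  have hA' : aperyNumber (M - 1) = ∑ k ∈ range M, aperyTerm (M - 1) k := by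
    rw [aperyNumber, Nat.sub_add_cancel hM1]
  rw [hA, hA']
  push_cast
  -- split by `p ∣ k`
  have hsplit : ∑ k ∈ range (M * p), ((aperyTerm (M * p - 1) k : ℕ) : ℤ) =
      ∑ k ∈ range (M * p), (if p ∣ k then 0 else ((aperyTerm (M * p - 1) k : ℕ) : ℤ)) +
        ∑ k ∈ range (M * p), (if p ∣ k then ((aperyTerm (M * p - 1) k : ℕ) : ℤ) else 0) := by
    rw [← Finset.sum_add_distrib]
    refine Finset.sum_congr rfl fun k _ => ?_
    split_ifs <;> simp
  rw [hsplit, sum_range_mul_ite_dvd hp0]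
  -- the multiples of `p`, termwise
  have hmult : ∑ K ∈ range M, ((aperyTerm (M * p - 1) (K * p) : ℕ) : ℤ) ≡
      ∑ K ∈ range M, ((aperyTerm (M - 1) K : ℕ) : ℤ) [ZMOD (p : ℤ) ^ (3 * r)] := by
    rw [Int.modEq_iff_dvd, ← Finset.sum_sub_distrib]
    refine Finset.dvd_sum fun K hK => ?_
    rw [Finset.mem_range] at hK
    rw [← Int.modEq_iff_dvd]
    rcases Nat.eq_zero_or_pos K with h0 | hK1
    · subst h0
      rw [zero_mul, aperyTerm_zero, aperyTerm_zero]
    · have h := shifted_term_modEq (p := p) h3 hr hMr hK1 hK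
      have hMp : 1 ≤ M * p := Nat.mul_pos hM1 hp0
      simp only [aperyTerm]
      rw [show M * p - 1 + K * p = M * p + K * p - 1 by omega, show M - 1 + K = M + K - 1 by omega]
      exact h
  have h0 : (∑ k ∈ range (M * p), (if p ∣ k then 0 else ((aperyTerm (M * p - 1) k : ℕ) : ℤ))) ≡ 0
      [ZMOD (p : ℤ) ^ (3 * r)] := Int.modEq_zero_iff_dvd.mpr hfree
  have := h0.add hmult
  simpa using this

/-- **Beukers 1985, Theorem 1 — the named fact `MultivariateAperyNumbers.beukers1985_supercongruence`
DISCHARGED**: for primes `p ≥ 5`, `r ≥ 1` and positive `m`, `A(p^r m − 1) ≡ A(p^{r−1} m − 1) (mod p^{3r})`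
(as printed in [Straub2014] (3); the `ℕ`-subtractions in `p ^ r * m - 1`, `p ^ (r - 1) * m - 1` are honest since
`m ≥ 1`, `r ≥ 1`). A DIFFERENT PROOF from the printed ones: NOT Beukers' §§2–3 (of which the author writes, p. 142,
«It would be very nice if a more natural proof of Theorem 1 were found instead of the "brute force method" we
employed»), and NOT a port of [Straub2014] Lemmas 5.4/5.5 to negative arguments `𝐧 = (−m,−m,−m,−m)`; instead the
two absorption identities of `AperyShiftedSupercongruenceRatioProofs` and the reflection `k ↦ N − k` reduce the
shifted argument to the tree's theorems at nonnegative arguments (Jacobsthal's congruence and [Straub2014] (46)).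
Nothing is claimed beyond the typed statement; in particular this file gives no new route to
`coster1988_supercongruence` (net 0 there). [cite: Beukers1985, Theorem 1 (second congruence)]
[cite: Straub2014, (3)] -/
theorem beukers1985_supercongruence_holds : MultivariateAperyNumbers.beukers1985_supercongruence := by
  intro p hpr h5 r hr m hm
  haveI : Fact p.Prime := ⟨hpr⟩
  exact aperyNumber_shifted_prime_pow_modEq (p := p) h5 hr hm

end Assembly

end Literature.Combinatorics.Enumerative.AperyShiftedSupercongruenceProofs
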